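import Summits.QuantumFields.YangMills.Theorems.LuscherReductionTwistedTraceScalingCovariantCurlLipschitz
import Summits.QuantumFields.YangMills.Theorems.LuscherReductionTwistedTraceScalingSpectralWeightContinuity
import Summits.QuantumFields.YangMills.Theorems.LuscherReductionTwistedTraceScalingSpectralWeightBounds
import Summits.QuantumFields.YangMills.Theorems.LuscherReductionTwistedTraceScalingStepKernelModel
import HarnessLib

/-!
# The covariant trial exponent at the moved point versus the Gaussian model weight on the chart ball
# (covariant programme, brick c4(iii) (m3): `q_{D_{W·U}}(F(W·U)) = q_{D_U}(F(U) + D_U x) ± E` for `W = P(y)`, `x = chartVec y`)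

Cell `ym-fleet`, crux `TwistedTraceScaling` (stmt-QuantumFields-20203), line «twolattice», stub S-BASE, lane B = COARSE-LOWER(L₁)
(design note `pub/ym-fleet/ym-20203-coarse-s1/LOWER-BLUEPRINT.md` §5–§6).  HONEST FRAMING: fixed-lattice bookkeeping; a stub of a child of the
CONDITIONAL reduction route (femto rung R2b1); not a gap, not Clay.

The covariant trial state is `H(V) = exp(−q_{D_V}(F(V)))` with `q_D(G) = ⟨D†G, g(D†D)D†G⟩` (`…SpectralWeight`).  Along a chart step `V = P(y)·U`,
`|y_e| ≤ ρ`, its exponent is the MODEL exponent `q_{D_U}(F(U) + D_U x)`, `x = chartVec y`, up to an explicit error: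

* `trialErr ρ σ N n m m₁ L` — the error budget: `D`-continuity (`Harm.abs_weightForm_sub_weightForm_le` with `C = C' = 10√N`,
  `C_Δ = 504ρ√N` from `…CovariantCurlLipschitz`) plus the curvature modulus (`Harm.abs_weightForm_sub_le'` with the c1/chart distances of
  `…StepKernelChart` / `…StepKernelModel`); at `ρ ≍ β^{−1/2}`, `σ ≍ β^{−1}`, `m, m₁, L = O(β)` (Riccati weight, `…SpectralWeightBounds`) it is `O(β^{−1/2})`;
* ★★ `abs_weightForm_step_sub_model_le` — `|q_{D_{W·U}}(F(W·U)) − q_{D_U}(F(U) + D_U x)| ≤ trialErr …`;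
* ★ `exp_neg_weightForm_step_le` / `exp_neg_model_le_step` — the two-sided exponential form
  `e^{−E} e^{−q_{D_U}(F+D_Ux)} ≤ H(P(y)·U) ≤ e^{E} e^{−q_{D_U}(F+D_Ux)}`: the test function of `…StepUpperModel` / `…StepLowerModel` is the
  integrand of `…HarmonicStepIntegral` up to `e^{±E}`.

## References
* M. Lüscher, Nucl. Phys. B219 (1983) 233, §3. [Luscher1983]
* F. Kittaneh, Proc. AMS 94 (1985) 416–418, Cor. 2. [Kittaneh1985]
-/

noncomputable section

open Real
open Literature.MathematicalPhysics.QuantumFieldTheory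
open Literature.MathematicalPhysics.QuantumLattice

namespace Summit.QuantumFields.YangMills.Theorems.FemtoTransferGap.TwoLattice.Cov

open Summit.QuantumFields.YangMills.Theorems.FemtoTransferGap
open Summit.QuantumFields.YangMills.Theorems.FemtoTransferGap.TwoLattice
open Summit.QuantumFields.YangMills.Theorems.FemtoTransferGap.TwoLattice.Stiff
open Summit.QuantumFields.YangMills.Theorems.FemtoTransferGap.TwoLattice.GnChart
open Summit.QuantumFields.YangMills.Theorems.FemtoTransferGap.TwoLattice.Harm

variable {L : ℕ} [NeZero L]

/-! ## §1 The error budget -/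

/-- The ERROR BUDGET of the trial exponent along a chart step of radius `ρ` at action level `σ`, with `N = 3|P|` (curvature components),
`n = 3|E|` (link components), weight bounds `0 ≤ g ≤ m`, `g(s)s ≤ m₁`, Lipschitz constant `L`:
`E = 504ρ√N·20√N·(L√n·100N + m)·A₁² + m₁·d·(A₁ + A₂)` with `A₂ = √σ + 10ρ√N`, `d = √N·stepRem ρ σ + 5ρ³√N`, `A₁ = A₂ + d`. [cite: Luscher1983, §3] -/
def trialErr (ρ σ N n m m₁ L : ℝ) : ℝ :=
  504 * ρ * Real.sqrt N * (10 * Real.sqrt N + 10 * Real.sqrt N) * (L * Real.sqrt n * (10 * Real.sqrt N) ^ 2 + m) *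
      (Real.sqrt σ + 10 * ρ * Real.sqrt N + (Real.sqrt N * stepRem ρ σ + 5 * ρ ^ 3 * Real.sqrt N)) ^ 2 +
    m₁ * (Real.sqrt N * stepRem ρ σ + 5 * ρ ^ 3 * Real.sqrt N) *
      ((Real.sqrt σ + 10 * ρ * Real.sqrt N + (Real.sqrt N * stepRem ρ σ + 5 * ρ ^ 3 * Real.sqrt N)) + (Real.sqrt σ + 10 * ρ * Real.sqrt N))

/-! ## §2 The comparison -/

section Step

variable {ρ σ : ℝ} (U : GaugeConfig 3 L SU2) (y : Edge 3 L → Fin 3 → ℝ)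

/-- The curvature after the step versus the chart model curvature: `‖F(P(y)·U) − (F(U) + D_U(chartVec y))‖ ≤ √N·stepRem + 5ρ³√N`.
[cite: Luscher1983, §3] -/
theorem norm_plaqCurv_step_sub_model_le (hρ0 : 0 ≤ ρ) (hρ : ρ ≤ 1 / 30) (hσ : σ ≤ 1 / 16) (hS : wilsonAction su2Rep U ≤ σ)
    (hy : ∀ e, ∑ a, y e a ^ 2 ≤ ρ ^ 2) :
    ‖plaqCurv (latPatternChart L (fun _ => false) y * U) - (plaqCurv U + covCurl U (chartVec y))‖ ≤
      Real.sqrt (Fintype.card (Plaquette 3 L × Fin 3)) * stepRem ρ σ + 5 * ρ ^ 3 * Real.sqrt (Fintype.card (Plaquette 3 L × Fin 3)) := by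
  have h1 := norm_plaqCurv_step_sub_le U y hρ0 hρ hσ hS hy
  have h2 := norm_covCurl_linkVec_sub_le U hρ0 hy
  have e : plaqCurv (latPatternChart L (fun _ => false) y * U) - (plaqCurv U + covCurl U (chartVec y)) =
      (plaqCurv (latPatternChart L (fun _ => false) y * U) - (plaqCurv U + covCurl U (linkVec L (latPatternChart L (fun _ => false) y)))) +
        (covCurl U (linkVec L (latPatternChart L (fun _ => false) y)) - covCurl U (chartVec y)) := by abel
  rw [e]
  exact (norm_add_le _ _).trans (add_le_add h1 h2)

/-- ★★ **THE TRIAL EXPONENT AT THE MOVED POINT IS THE MODEL EXPONENT UP TO `trialErr`.**  For `0 ≤ g ≤ m`, `g(s)s ≤ m₁` (`s ≥ 0`),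
`|g s − g t| ≤ L|s − t|` (`L ≥ 0`), `0 ≤ ρ ≤ 1/30`, `σ ≤ 1/16`, `S(U) ≤ σ`, `|y_e|² ≤ ρ²`:
`|q_{D_{P(y)·U}}(F(P(y)·U)) − q_{D_U}(F(U) + D_U(chartVec y))| ≤ trialErr ρ σ N n m m₁ L`. [cite: Luscher1983, §3] [cite: Kittaneh1985, Cor. 2] -/
theorem abs_weightForm_step_sub_model_le {g : ℝ → ℝ} {m m₁ Lg : ℝ} (hg0 : ∀ s, 0 ≤ g s) (hgm : ∀ s, g s ≤ m)
    (hgm₁ : ∀ s, 0 ≤ s → g s * s ≤ m₁) (hL : 0 ≤ Lg) (hLip : ∀ s t, |g s - g t| ≤ Lg * |s - t|) (hρ0 : 0 ≤ ρ) (hρ : ρ ≤ 1 / 30)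
    (hσ : σ ≤ 1 / 16) (hS : wilsonAction su2Rep U ≤ σ) (hy : ∀ e, ∑ a, y e a ^ 2 ≤ ρ ^ 2) :
    |weightForm g (covCurl (latPatternChart L (fun _ => false) y * U)) (plaqCurv (latPatternChart L (fun _ => false) y * U)) -
        weightForm g (covCurl U) (plaqCurv U + covCurl U (chartVec y))| ≤
      trialErr ρ σ (Fintype.card (Plaquette 3 L × Fin 3)) (Fintype.card (Edge 3 L × Fin 3)) m m₁ Lg := by
  set W := latPatternChart L (fun _ => false) y
  set N : ℝ := (Fintype.card (Plaquette 3 L × Fin 3) : ℝ)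
  set F' := plaqCurv (W * U)
  set G' := plaqCurv U + covCurl U (chartVec y)
  set d := Real.sqrt N * stepRem ρ σ + 5 * ρ ^ 3 * Real.sqrt N with hd
  set A₂ := Real.sqrt σ + 10 * ρ * Real.sqrt N with hA₂
  -- step bounds
  obtain ⟨-, hv⟩ := chart_step_bounds (L := L) hρ0 hy
  have hC : ∀ w, ‖covCurl U w‖ ≤ 10 * Real.sqrt N * ‖w‖ := norm_covCurl_le_op U
  have hC' : ∀ w, ‖covCurl (W * U) w‖ ≤ 10 * Real.sqrt N * ‖w‖ := norm_covCurl_le_op (W * U)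
  have hΔ : ∀ w, ‖(covCurl (W * U) - covCurl U) w‖ ≤ 504 * ρ * Real.sqrt N * ‖w‖ := fun w => by
    rw [LinearMap.sub_apply]; exact norm_covCurl_step_sub_le U (by linarith) hv w
  -- norms
  have hdist : ‖F' - G'‖ ≤ d := norm_plaqCurv_step_sub_model_le U y hρ0 hρ hσ hS hy
  have hG' : ‖G'‖ ≤ A₂ := norm_model_le U y hρ0 hS hy
  have hF' : ‖F'‖ ≤ A₂ + d := by
    have := norm_add_le G' (F' - G'); rw [add_sub_cancel] at this; linarith
  have hd0 : 0 ≤ d := (norm_nonneg _).trans hdist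
  have hA20 : 0 ≤ A₂ := (norm_nonneg _).trans hG'
  have hm₁ : 0 ≤ m₁ := by simpa using hgm₁ 0 le_rfl
  -- T1: continuity in `D`
  have hT1 := abs_weightForm_sub_weightForm_le hg0 hgm hL hLip (D := covCurl U) (D' := covCurl (W * U)) (by positivity) (by positivity)
    (by positivity) hC hC' hΔ F'
  -- T2: modulus in the curvature
  have hT2 := abs_weightForm_sub_le' hg0 hgm₁ (covCurl U) F' G'
  -- combine
  have htri : |weightForm g (covCurl (W * U)) F' - weightForm g (covCurl U) G'| ≤
      |weightForm g (covCurl (W * U)) F' - weightForm g (covCurl U) F'| + |weightForm g (covCurl U) F' - weightForm g (covCurl U) G'| := by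
    have := abs_sub_le (weightForm g (covCurl (W * U)) F') (weightForm g (covCurl U) F') (weightForm g (covCurl U) G')
    exact this
  refine htri.trans ?_
  have hK1 : 0 ≤ 504 * ρ * Real.sqrt N * (10 * Real.sqrt N + 10 * Real.sqrt N) *
      (Lg * Real.sqrt (Fintype.card (Edge 3 L × Fin 3)) * (10 * Real.sqrt N) ^ 2 + m) := by
    have hm : 0 ≤ m := (hg0 0).trans (hgm 0)
    positivity
  have h1' : |weightForm g (covCurl (W * U)) F' - weightForm g (covCurl U) F'| ≤
      504 * ρ * Real.sqrt N * (10 * Real.sqrt N + 10 * Real.sqrt N) *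
        (Lg * Real.sqrt (Fintype.card (Edge 3 L × Fin 3)) * (10 * Real.sqrt N) ^ 2 + m) * (A₂ + d) ^ 2 :=
    hT1.trans (mul_le_mul_of_nonneg_left (pow_le_pow_left₀ (norm_nonneg _) hF' 2) hK1)
  have h2' : |weightForm g (covCurl U) F' - weightForm g (covCurl U) G'| ≤ m₁ * d * ((A₂ + d) + A₂) := by
    refine hT2.trans ?_
    have := mul_le_mul (mul_le_mul_of_nonneg_left hdist hm₁) (add_le_add hF' hG') (by positivity) (by positivity)
    simpa [mul_assoc] using this
  unfold trialErr
  rw [← hd, ← hA₂]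
  linarith

/-- ★ Exponential form, upper: `H(P(y)·U) ≤ e^{E} · e^{−q_{D_U}(F(U) + D_U x)}`. [cite: Luscher1983, §3] -/
theorem exp_neg_weightForm_step_le {g : ℝ → ℝ} {m m₁ Lg : ℝ} (hg0 : ∀ s, 0 ≤ g s) (hgm : ∀ s, g s ≤ m)
    (hgm₁ : ∀ s, 0 ≤ s → g s * s ≤ m₁) (hL : 0 ≤ Lg) (hLip : ∀ s t, |g s - g t| ≤ Lg * |s - t|) (hρ0 : 0 ≤ ρ) (hρ : ρ ≤ 1 / 30)
    (hσ : σ ≤ 1 / 16) (hS : wilsonAction su2Rep U ≤ σ) (hy : ∀ e, ∑ a, y e a ^ 2 ≤ ρ ^ 2) :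
    Real.exp (-weightForm g (covCurl (latPatternChart L (fun _ => false) y * U)) (plaqCurv (latPatternChart L (fun _ => false) y * U))) ≤
      Real.exp (trialErr ρ σ (Fintype.card (Plaquette 3 L × Fin 3)) (Fintype.card (Edge 3 L × Fin 3)) m m₁ Lg) *
        Real.exp (-weightForm g (covCurl U) (plaqCurv U + covCurl U (chartVec y))) := by
  rw [← Real.exp_add, Real.exp_le_exp]
  have h := abs_weightForm_step_sub_model_le U y hg0 hgm hgm₁ hL hLip hρ0 hρ hσ hS hy
  rw [abs_le] at h
  linarith [h.1]

/-- ★ Exponential form, lower: `e^{−E} · e^{−q_{D_U}(F(U) + D_U x)} ≤ H(P(y)·U)`. [cite: Luscher1983, §3] -/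
theorem exp_neg_model_le_step {g : ℝ → ℝ} {m m₁ Lg : ℝ} (hg0 : ∀ s, 0 ≤ g s) (hgm : ∀ s, g s ≤ m)
    (hgm₁ : ∀ s, 0 ≤ s → g s * s ≤ m₁) (hL : 0 ≤ Lg) (hLip : ∀ s t, |g s - g t| ≤ Lg * |s - t|) (hρ0 : 0 ≤ ρ) (hρ : ρ ≤ 1 / 30)
    (hσ : σ ≤ 1 / 16) (hS : wilsonAction su2Rep U ≤ σ) (hy : ∀ e, ∑ a, y e a ^ 2 ≤ ρ ^ 2) :
    Real.exp (-trialErr ρ σ (Fintype.card (Plaquette 3 L × Fin 3)) (Fintype.card (Edge 3 L × Fin 3)) m m₁ Lg) *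
        Real.exp (-weightForm g (covCurl U) (plaqCurv U + covCurl U (chartVec y))) ≤
      Real.exp (-weightForm g (covCurl (latPatternChart L (fun _ => false) y * U)) (plaqCurv (latPatternChart L (fun _ => false) y * U))) := by
  rw [← Real.exp_add, Real.exp_le_exp]
  have h := abs_weightForm_step_sub_model_le U y hg0 hgm hgm₁ hL hLip hρ0 hρ hσ hS hy
  rw [abs_le] at h
  linarith [h.2]

end Step

end Summit.QuantumFields.YangMills.Theorems.FemtoTransferGap.TwoLattice.Cov

end
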